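import Summits.AtomisticToContinuum.HydrodynamicLimit.Theorems.KineticCurrentsWindowLDUniform.Negative.WindowSum

/-!
# The drift-tilt lower bound for window exponential functionals (crux `KineticCurrentsWindowLDUniform`, 3/3)

Negative knowledge for the crux `OneFlightGossipEngine.KineticCurrentsWindowLDUniform`
(stmt-AtomisticToContinuum-14662), from the standing disprover's `Cruxes/KineticCurrentsWindowLDUniform/Disproof.lean`
§ 3; part 3 of `Negative/{WindowFubini, WindowSum, TiltWindow, LoadBearing}`.

`tilt_window_lower_bound`: for `0 < σ ≤ 1/2`, every `N`, EVERY hard-sphere flow `Φ`, every window `w > 0`, every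
drift `u₁ ∈ ℝ³` and every continuous `g` with `|g| ≤ C(1+‖v‖²)^m`,
`exp((N+1)·(E_{N(u₁,I)} g − ‖u₁‖²/2)) ≤ ∫ exp(∑ᵢ w⁻¹∫₀ʷ g(vᵢ(r)) dr) dG_N` — Donsker–Varadhan (Jensen under the
drifted homogeneous Gibbs law `G_N^{u₁}`; equal partition functions give the tilt identity
`G_N = G_N^{u₁}·e^{∑ llr1}`, tree: `KineticFluxLdDecayTilt.localGibbsMeasure_ref_eq_withDensity`), where the
flow-INVARIANCE of `G_N^{u₁}` makes the mean of the window average the static one-body mean (part 2), at entropy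
cost `(N+1)‖u₁‖²/2`. Two instances, uniform in the window and the flow:
* `lintegral_exp_shear_window_eq_top`: for the kinetic shear stress `g = β v₀v₁` and `β > 1` the functional is
  `+∞` (drifts `(s,s,0)`: gain `βs²`, cost `s²`), i.e. time averaging does NOT enlarge the static domain
  `|β| < 1 = 1/(2θλ_max(A_sym))` of finiteness — the crux's `β₀` is load-bearing and `≤ 1/(2 sup θ₀ λ_max(A_sym))`;
* `exp_le_lintegral_exp_momentum_window`: for `g = β v₀` (a `b·w`-functional WITHOUT `⊥ v_j`) the functional is
  `≥ e^{(N+1)β²/2}`, its full static value, at every window (drift `βe₀`).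
These feed the refuted variants of `Negative/LoadBearing.lean`. refuter-cdisprove-stmt-AtomisticToContinuum-14662-0.
-/

noncomputable section

namespace Summit.AtomisticToContinuum.HydrodynamicLimit.Theorems
namespace KineticCurrentsWindowTilt

open MeasureTheory ProbabilityTheory Filter Set Topology Real
open scoped ENNReal NNReal InnerProductSpace
open Literature.MathematicalPhysics.KineticTheory Literature.Analysis.FluidPDE
open KineticFluxLdDecayTilt (llr1 llr1_eq llrConfig measurable_llrConfig continuous_llr1
  localGibbsMeasure_ref_eq_withDensity ofReal_exp_integral_le_lintegral integral_eq_zero_of_odd_stdGaussian)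

section Tilt

variable {σ : ℝ} {N : ℕ} (hσ2 : σ ≤ 1 / 2)
include hσ2

/-! ### C'. The Donsker–Varadhan step -/

omit hσ2 in
/-- Closed form of the one-particle log-likelihood ratio at `θ₁ = 1`: `llr1 1 u₁ v = ‖u₁‖²/2 − ⟪v, u₁⟫`. [folklore] -/
theorem llr1_one_eq (u₁ v : V3) : llr1 1 u₁ v = ‖u₁‖ ^ 2 / 2 - ⟪v, u₁⟫_ℝ := by
  rw [llr1_eq one_pos, Real.log_one, mul_zero, zero_sub, mul_one, norm_sub_sq_real]
  ring

omit hσ2 in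
/-- `llr1 1 u₁` has quadratic growth. [folklore] -/
theorem abs_llr1_one_le (u₁ v : V3) : |llr1 1 u₁ v| ≤ (1 + ‖u₁‖ ^ 2) * (1 + ‖v‖ ^ 2) := by
  rw [llr1_one_eq]
  have h1 : |⟪v, u₁⟫_ℝ| ≤ ‖v‖ * ‖u₁‖ := abs_real_inner_le_norm v u₁
  have h2 := abs_sub (‖u₁‖ ^ 2 / 2) ⟪v, u₁⟫_ℝ
  rw [abs_of_nonneg (by positivity : (0 : ℝ) ≤ ‖u₁‖ ^ 2 / 2)] at h2
  nlinarith [norm_nonneg v, norm_nonneg u₁, sq_nonneg (‖v‖ - ‖u₁‖), mul_nonneg (norm_nonneg v) (norm_nonneg u₁),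
    sq_nonneg ‖v‖, sq_nonneg ‖u₁‖, mul_nonneg (sq_nonneg ‖v‖) (sq_nonneg ‖u₁‖)]

omit hσ2 in
/-- `⟪·, u₁⟫` is integrable under the standard Gaussian. [folklore] -/
theorem integrable_inner_stdGaussian (u₁ : V3) : Integrable (fun w : V3 => ⟪w, u₁⟫_ℝ) (stdGaussian V3) := by
  have hdom : Integrable (fun w : V3 => ‖u₁‖ * (1 + ‖w‖ ^ 2)) (stdGaussian V3) :=
    ((integrable_const (1 : ℝ)).add integrable_norm_sq_stdGaussian).const_mul ‖u₁‖
  refine hdom.mono' (by fun_prop : Continuous fun w : V3 => ⟪w, u₁⟫_ℝ).aestronglyMeasurable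
    (ae_of_all _ fun w => ?_)
  rw [Real.norm_eq_abs]
  refine (abs_real_inner_le_norm w u₁).trans ?_
  nlinarith [norm_nonneg w, norm_nonneg u₁, sq_nonneg (‖w‖ - 1), mul_nonneg (norm_nonneg u₁) (sq_nonneg (‖w‖ - 1))]

omit hσ2 in
/-- **Mean log-likelihood ratio under the drifted law = minus the relative entropy per particle**:
`∫ llr1 1 u₁ d(gaussMeasure u₁ 1) = −‖u₁‖²/2`. [folklore] -/
theorem integral_llr1_gaussMeasure (u₁ : V3) : ∫ v, llr1 1 u₁ v ∂gaussMeasure u₁ 1 = -(‖u₁‖ ^ 2 / 2) := by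
  rw [integral_gaussMeasure u₁ one_pos]
  simp_rw [llr1_one_eq, Real.sqrt_one, one_smul, inner_add_left, real_inner_self_eq_norm_sq]
  have h : ∀ w : V3, ‖u₁‖ ^ 2 / 2 - (‖u₁‖ ^ 2 + ⟪w, u₁⟫_ℝ) = -(‖u₁‖ ^ 2 / 2) - ⟪w, u₁⟫_ℝ := by
    intro w; ring
  simp_rw [h]
  rw [integral_sub (integrable_const _) (integrable_inner_stdGaussian u₁), integral_const]
  simp only [Measure.real, measure_univ, ENNReal.toReal_one, one_smul]
  have hodd : ∫ w : V3, ⟪w, u₁⟫_ℝ ∂stdGaussian V3 = 0 :=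
    integral_eq_zero_of_odd_stdGaussian fun w => by rw [inner_neg_left]
  rw [hodd, sub_zero]

/-- The configuration log-likelihood ratio is integrable under the drifted law, with mean `−(N+1)‖u₁‖²/2`. [folklore] -/
theorem integral_llrConfig_driftLaw (u₁ : V3)
    (Φ : HardSphereFlow (Torus.geometry (Fin 3)) (hsDiameter σ N) (N + 1)) :
    Integrable (llrConfig 1 u₁ : Config (N + 1) (Fin 3) T3 → ℝ) (localGibbsLaw σ (fun _ => 1) (fun _ => u₁) (fun _ => 1) N Φ) ∧
      ∫ z, llrConfig 1 u₁ z ∂(localGibbsLaw σ (fun _ => 1) (fun _ => u₁) (fun _ => 1) N Φ) = -((N + 1) * (‖u₁‖ ^ 2 / 2)) := by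
  have hterm : ∀ i : Fin (N + 1), Integrable (fun z : Config (N + 1) (Fin 3) T3 => llr1 1 u₁ ((z i).2))
      (localGibbsLaw σ (fun _ => 1) (fun _ => u₁) (fun _ => 1) N Φ) := fun i => by
    rw [localGibbsLaw_eq]
    exact integrable_vel_localGibbsMeasure_const hσ2 one_pos one_pos u₁ N i (continuous_llr1 one_pos u₁)
      (m := 1) (fun v => by rw [pow_one]; exact abs_llr1_one_le u₁ v)
  refine ⟨?_, ?_⟩
  · have := integrable_finsetSum (Finset.univ : Finset (Fin (N + 1))) fun i _ => hterm i
    refine this.congr (ae_of_all _ fun z => ?_)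
    simp [llrConfig]
  · unfold llrConfig
    rw [integral_finsetSum _ fun i _ => hterm i]
    have h1 : ∀ i : Fin (N + 1), ∫ z : Config (N + 1) (Fin 3) T3, llr1 1 u₁ ((z i).2) ∂(localGibbsLaw σ (fun _ => 1) (fun _ => u₁) (fun _ => 1) N Φ) =
        -(‖u₁‖ ^ 2 / 2) := fun i => by
      rw [localGibbsLaw_eq, integral_vel_localGibbsMeasure_const hσ2 one_pos one_pos u₁ N i
        (continuous_llr1 one_pos u₁), integral_llr1_gaussMeasure]
    simp_rw [h1]
    simp only [Finset.sum_const, Finset.card_univ, Fintype.card_fin]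
    ring

/-- **THE DRIFT-TILT LOWER BOUND FOR WINDOW EXPONENTIAL FUNCTIONALS.** For `0 < σ ≤ 1/2`, every `N`, EVERY
hard-sphere flow `Φ`, every window `w > 0`, every drift `u₁ ∈ ℝ³` and every continuous `g` with `|g| ≤ C(1+‖v‖²)^m`:
`exp((N+1)·(E_{N(u₁,I)} g − ‖u₁‖²/2)) ≤ ∫ exp(∑ᵢ w⁻¹∫₀ʷ g(vᵢ(r)) dr) dG_N` — Donsker–Varadhan with the drifted
homogeneous Gibbs law `G_N^{u₁}` (equal partition functions, `G_N = G_N^{u₁}·e^{∑ llr1}`), whose flow-INVARIANCE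
makes the mean of the window average equal to the static one-body mean `(N+1) E_{N(u₁,I)} g`, at entropy cost
`(N+1)‖u₁‖²/2`; uniform in the window and in the flow. [folklore] -/
theorem tilt_window_lower_bound (Φ : HardSphereFlow (Torus.geometry (Fin 3)) (hsDiameter σ N) (N + 1))
    (u₁ : V3) {w : ℝ} (hw : 0 < w) {g : V3 → ℝ} (hg : Continuous g) {C : ℝ} {m : ℕ}
    (hC : ∀ v, |g v| ≤ C * (1 + ‖v‖ ^ 2) ^ m) :
    ENNReal.ofReal (Real.exp ((N + 1) * (∫ v, g v ∂gaussMeasure u₁ 1 - ‖u₁‖ ^ 2 / 2))) ≤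
      ∫⁻ z, ENNReal.ofReal (Real.exp ((∑ i, w⁻¹ * ∫ r in (0 : ℝ)..w, g ((Φ.flow r z) i).2))) ∂(localGibbsLaw σ (fun _ => 1) (fun _ => 0) (fun _ => 1) N Φ) := by
  haveI := isProbabilityMeasure_driftLaw hσ2 u₁ Φ
  set Q := localGibbsLaw σ (fun _ => 1) (fun _ => u₁) (fun _ => 1) N Φ with hQ
  have hW : Integrable (fun z => ∑ i, w⁻¹ * ∫ r in (0 : ℝ)..w, g ((Φ.flow r z) i).2) Q := integrable_windowSum hσ2 Φ u₁ hw hg hC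
  obtain ⟨hL, hLint⟩ := integral_llrConfig_driftLaw hσ2 u₁ Φ
  have hWm : AEMeasurable (fun z => ∑ i, w⁻¹ * ∫ r in (0 : ℝ)..w, g ((Φ.flow r z) i).2) Q := aemeasurable_windowSum Φ w hg.measurable (driftLaw_compl_good u₁ Φ)
  have hLm : Measurable (llrConfig 1 u₁ : Config (N + 1) (Fin 3) T3 → ℝ) := measurable_llrConfig one_pos u₁ _
  -- the reference law is the tilted drifted law
  have hP : (localGibbsLaw σ (fun _ => 1) (fun _ => 0) (fun _ => 1) N Φ) = Q.withDensity fun z => ENNReal.ofReal (Real.exp (llrConfig 1 u₁ z)) := by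
    rw [localGibbsLaw_eq, localGibbsMeasure_ref_eq_withDensity σ one_pos u₁ N, hQ, localGibbsLaw_eq]
  -- Jensen under `Q`
  have hJ := ofReal_exp_integral_le_lintegral Q (hW.add hL)
  rw [integral_add' hW hL, integral_windowSum hσ2 Φ u₁ hw hg hC, hLint] at hJ
  have hexp : ((N : ℝ) + 1) * (∫ v, g v ∂gaussMeasure u₁ 1 - ‖u₁‖ ^ 2 / 2) =
      ((N : ℝ) + 1) * ∫ v, g v ∂gaussMeasure u₁ 1 + -(((N : ℝ) + 1) * (‖u₁‖ ^ 2 / 2)) := by ring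
  rw [hexp]
  refine hJ.trans (le_of_eq ?_)
  rw [hP, lintegral_withDensity_eq_lintegral_mul₀ hLm.exp.ennreal_ofReal.aemeasurable
    hWm.exp.ennreal_ofReal]
  refine lintegral_congr fun z => ?_
  simp only [Pi.add_apply, Pi.mul_apply]
  rw [Real.exp_add, ENNReal.ofReal_mul (Real.exp_pos _).le, mul_comm]

/-! ### D. Two instances: the shear stress beyond `β = 1`, and a momentum component -/

omit hσ2 in
/-- Coordinates of the diagonal drift. [folklore] -/
theorem diagDrift_apply (s : ℝ) : (EuclideanSpace.single 0 s + EuclideanSpace.single 1 s : V3) 0 = s ∧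
    (EuclideanSpace.single 0 s + EuclideanSpace.single 1 s : V3) 1 = s ∧
    (EuclideanSpace.single 0 s + EuclideanSpace.single 1 s : V3) 2 = 0 := by
  simp

omit hσ2 in
/-- `‖(s,s,0)‖² = 2s²`. [folklore] -/
theorem norm_diagDrift_sq (s : ℝ) : ‖(EuclideanSpace.single 0 s + EuclideanSpace.single 1 s : V3)‖ ^ 2 = 2 * s ^ 2 := by
  rw [BoltzmannGreenKuboForallN.norm_sq_eq_three]
  obtain ⟨h0, h1, h2⟩ := diagDrift_apply s
  rw [h0, h1, h2]
  ring

omit hσ2 in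
/-- The kinetic shear stress `β v₀ v₁` has quadratic growth. [folklore] -/
theorem abs_shear_le (β : ℝ) (v : V3) : |β * (v 0 * v 1)| ≤ |β| * (1 + ‖v‖ ^ 2) := by
  rw [abs_mul]
  refine mul_le_mul_of_nonneg_left ?_ (abs_nonneg β)
  rw [BoltzmannGreenKuboForallN.norm_sq_eq_three, abs_le]
  constructor <;> nlinarith [sq_nonneg (v 0 + v 1), sq_nonneg (v 0 - v 1), sq_nonneg (v 2)]

omit hσ2 in
/-- **Mean shear stress under the diagonally drifted Maxwellian**: `E_{N((s,s,0),I)}[β v₀v₁] = β s²`. [folklore] -/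
theorem integral_shear_gaussMeasure_diagDrift (β s : ℝ) :
    ∫ v, β * (v 0 * v 1) ∂gaussMeasure ((EuclideanSpace.single 0 s + EuclideanSpace.single 1 s : V3)) 1 = β * s ^ 2 := by
  rw [integral_const_mul, integral_gaussMeasure _ one_pos]
  congr 1
  have hc : ∀ w : V3, (EuclideanSpace.single 0 s + EuclideanSpace.single 1 s + w : V3) 0 = s + w 0 ∧
      (EuclideanSpace.single 0 s + EuclideanSpace.single 1 s + w : V3) 1 = s + w 1 := fun w => by
    constructor <;> simp [PiLp.add_apply]
  simp_rw [Real.sqrt_one, one_smul, (hc _).1, (hc _).2]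
  have hsplit : ∀ w : V3, (s + w 0) * (s + w 1) = s ^ 2 + (s * w 0 + s * w 1 + w 0 * w 1) := by
    intro w; ring
  simp_rw [hsplit]
  have hi0 : Integrable (fun w : V3 => w 0) (stdGaussian V3) := (memLp_coord_stdGaussian 0 1 (by simp)).integrable le_rfl
  have hi1 : Integrable (fun w : V3 => w 1) (stdGaussian V3) := (memLp_coord_stdGaussian 1 1 (by simp)).integrable le_rfl
  have hi01 : Integrable (fun w : V3 => w 0 * w 1) (stdGaussian V3) := by
    refine (integrable_norm_sq_stdGaussian).mono' ?_ (ae_of_all _ fun w => ?_)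
    · exact ((EuclideanSpace.proj (𝕜 := ℝ) (0 : Fin 3)).continuous.mul
        (EuclideanSpace.proj (𝕜 := ℝ) (1 : Fin 3)).continuous).aestronglyMeasurable
    · rw [Real.norm_eq_abs, BoltzmannGreenKuboForallN.norm_sq_eq_three, abs_le]
      constructor <;> nlinarith [sq_nonneg (w 0 + w 1), sq_nonneg (w 0 - w 1), sq_nonneg (w 2)]
  have hB : Integrable (fun w : V3 => s * w 0 + s * w 1) (stdGaussian V3) := (hi0.const_mul s).add (hi1.const_mul s)
  have hA : Integrable (fun w : V3 => s * w 0 + s * w 1 + w 0 * w 1) (stdGaussian V3) := hB.add hi01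
  rw [integral_add (integrable_const _) hA, integral_add hB hi01, integral_add (hi0.const_mul s) (hi1.const_mul s),
    integral_const_mul, integral_const_mul, integral_coord_stdGaussian, integral_coord_stdGaussian,
    BoltzmannGreenKuboForallN.integral_stdGaussian_eq_zero_of_odd (BoltzmannGreenKuboForallN.reflB 0)
      (G := fun w : V3 => w 0 * w 1) (fun w => by simp [BoltzmannGreenKuboForallN.reflB_apply]),
    integral_const]
  simp only [Measure.real, measure_univ, ENNReal.toReal_one, one_smul]
  ring

/-- **Beyond `β = 1` the window functional of the shear stress is INFINITE**, for every `0 < σ ≤ 1/2`, `N`, flow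
and window: `∫ exp(β ∑ᵢ w⁻¹∫₀ʷ v_{i,0}v_{i,1} dr) dG_N = ∞` when `β > 1` (drifts `(s,s,0)`, `s → ∞`: gain `βs²`,
cost `s²` per particle). So the static integrability threshold `β < 1 = 1/(2θλ_max(A))` of `∫e^{βF}M` is NOT
improved by time averaging: the crux's `β₀` must satisfy `β₀ ≤ 1/(2 sup θ₀ · λ_max(A_sym))`, uniformly in `τ`. [folklore] -/
theorem lintegral_exp_shear_window_eq_top (Φ : HardSphereFlow (Torus.geometry (Fin 3)) (hsDiameter σ N) (N + 1))
    {w : ℝ} (hw : 0 < w) {β : ℝ} (hβ : 1 < β) :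
    ∫⁻ z, ENNReal.ofReal (Real.exp (β * (∑ i, w⁻¹ * ∫ r in (0 : ℝ)..w, ((Φ.flow r z) i).2 0 * ((Φ.flow r z) i).2 1))) ∂(localGibbsLaw σ (fun _ => 1) (fun _ => 0) (fun _ => 1) N Φ) = ⊤ := by
  refine ENNReal.eq_top_of_forall_nnreal_le fun r => ?_
  -- choose the drift size
  set s : ℝ := Real.sqrt ((r : ℝ) / ((N + 1) * (β - 1))) with hs
  have hden : 0 < ((N : ℝ) + 1) * (β - 1) := by
    have : (0 : ℝ) < (N : ℝ) + 1 := by positivity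
    exact mul_pos this (by linarith)
  have hs2 : s ^ 2 = (r : ℝ) / ((N + 1) * (β - 1)) := Real.sq_sqrt (div_nonneg r.2 hden.le)
  have hkey := tilt_window_lower_bound hσ2 Φ ((EuclideanSpace.single 0 s + EuclideanSpace.single 1 s : V3)) hw
    (g := fun v => β * (v 0 * v 1)) (by fun_prop) (m := 1) (fun v => by rw [pow_one]; exact abs_shear_le β v)
  rw [integral_shear_gaussMeasure_diagDrift, norm_diagDrift_sq] at hkey
  simp_rw [window_sum_const_mul Φ w β (fun v : V3 => v 0 * v 1)] at hkey
  refine le_trans ?_ hkey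
  have hβ1 : β - 1 ≠ 0 := by linarith
  have hN1 : (N : ℝ) + 1 ≠ 0 := by positivity
  have hexp : ((N : ℝ) + 1) * (β * s ^ 2 - 2 * s ^ 2 / 2) = r := by
    rw [hs2]; field_simp
  rw [hexp, ← ENNReal.ofReal_coe_nnreal]
  exact ENNReal.ofReal_le_ofReal ((by linarith [Real.add_one_le_exp (r : ℝ)]) : (r : ℝ) ≤ Real.exp r)

/-- **A momentum component never decorrelates at exponential scale**: for `g(v) = β v₀` (the `b·w` part of the
crux's class with `G ≡ 1`, i.e. WITHOUT the orthogonality to `v_j`), every `0 < σ ≤ 1/2`, `N`, flow and window,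
`∫ exp(β ∑ᵢ w⁻¹∫₀ʷ v_{i,0}(r) dr) dG_N ≥ exp((N+1) β²/2)` (drift `β e₀`: gain `β²`, cost `β²/2`) — the full
static value `E e^{βP₀} = e^{(N+1)β²/2}`, at every window. [folklore] -/
theorem exp_le_lintegral_exp_momentum_window (Φ : HardSphereFlow (Torus.geometry (Fin 3)) (hsDiameter σ N) (N + 1))
    {w : ℝ} (hw : 0 < w) (β : ℝ) :
    ENNReal.ofReal (Real.exp ((N + 1) * (β ^ 2 / 2))) ≤
      ∫⁻ z, ENNReal.ofReal (Real.exp (β * (∑ i, w⁻¹ * ∫ r in (0 : ℝ)..w, ((Φ.flow r z) i).2 0))) ∂(localGibbsLaw σ (fun _ => 1) (fun _ => 0) (fun _ => 1) N Φ) := by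
  have hC : ∀ v : V3, |β * v 0| ≤ |β| * (1 + ‖v‖ ^ 2) ^ 1 := by
    intro v
    rw [pow_one, abs_mul]
    refine mul_le_mul_of_nonneg_left ?_ (abs_nonneg β)
    rw [BoltzmannGreenKuboForallN.norm_sq_eq_three, abs_le]
    constructor <;> nlinarith [sq_nonneg (v 0 + 1), sq_nonneg (v 0 - 1), sq_nonneg (v 1), sq_nonneg (v 2)]
  have hkey := tilt_window_lower_bound hσ2 Φ (EuclideanSpace.single 0 β) hw
    (g := fun v => β * v 0) (by fun_prop) hC
  have h1 : (EuclideanSpace.single (0 : Fin 3) β : V3) 0 = β := by simp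
  have h2 : ‖(EuclideanSpace.single (0 : Fin 3) β : V3)‖ = |β| := by
    rw [EuclideanSpace.single, PiLp.norm_single, Real.norm_eq_abs]
  rw [integral_const_mul, integral_coord_gaussMeasure _ one_pos, h1, h2, sq_abs] at hkey
  simp_rw [window_sum_const_mul Φ w β (fun v : V3 => v 0)] at hkey
  have hexp : ((N : ℝ) + 1) * (β * β - β ^ 2 / 2) = ((N : ℝ) + 1) * (β ^ 2 / 2) := by ring
  rw [hexp] at hkey
  exact hkey

end Tilt

end KineticCurrentsWindowTilt
end Summit.AtomisticToContinuum.HydrodynamicLimit.Theorems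

end
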